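import Summits.QuantumFields.YangMills.Theorems.UnitScaleTiltProp7GrowthAssembly
import HarnessLib

/-!
# Route `UnitScaleTilt`, crux K1 child «MinimiserStabilityRegPr» (stmt-QuantumFields-19200), registered stub `stub_prop7From14` (leaf V3 «Prop 7 from a
# background (14)») — **A COVARIANT RIGHT INVERSE OF THE LINEARISED MODEL AVERAGE AT A SMALL-FIELD BACKGROUND, WITH THE `ℓ¹` BOUND
# `Σ_b‖HW(b)‖ ≤ (L^k(1 − 2dL^{2k}a))⁻¹·Σ_c‖W(c)‖`** (hypothesis `H` of `Prop7GrowthAssembly.wilsonAction4_sub_background_ge_of_modelCritical_T3`, discharged)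

Cell `ym3-torus` ∕ fleet seat `ym-ust-19200-p1` (gen 5).  The model instance of the `ℓ²` growth assembly (p528174) takes a right inverse `H` of the linearised model
average `T_{U₀}` (block sums of the comb∘line-transported field; p520587/p521440) with `Σ_b‖HW(b)‖ ≤ B·L^{−(K−n)}·Σ_c‖W(c)‖`.  At the flat background the far-face
field of [Balaban1984PropagatorsI] (1.12) does it with `B = 1` (`B5Eq112RenormTransf.faceField`; p2 lineage `Prop7AvgLinearisation.linAvg_faceField_inv`).  At a
unitary background with plaquette variables within `a` of `1` the same support works: a far-face bond `f` of `B(c₋)` lies on the `L^k` straight contours issuing from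
the sites behind it, so `T_{U₀}(HW)(c) = Σ_f S_f(HW(f))`, `S_f = Σ_{s<L^k}R(w_{f,s})`, `w_{f,s}` = comb transport to the `s`-th site behind `f` then the straight
transport to `f`.  Two such transports differ by a loop inside the block: `‖R(w_{f,s})X − R(w_{f,L^k−1})X‖ ≤ 2dL^{2k}a‖X‖` (the comb-gauge difference estimate
`Prop7CovariantCoercivity.norm_conjR_comb_sub_le`, p473711, iterated along the contour); hence `‖S_fX‖ ≥ L^k(1 − θ)‖X‖`, `θ = 2dL^{2k}a`, and `S_f`, a linear map of
the finite-dimensional `M_N(ℂ)`, is onto with `‖S_f⁻¹‖ ≤ (L^k(1−θ))⁻¹` (injective ⇒ surjective; no Neumann series).  `HW` := on each far-face bond of `B(c₋)` the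
solution of `S_fX = (#far faces)⁻¹W(c)`, zero elsewhere.

WHAT IS PROVED (sorry-free, no definition; [folklore] finite-dimensional linear algebra ∕ cited where a printed step is instantiated): §1 `exists_preimage_of_le_norm`,
`exists_preimage_sum_conjR`; §2 `norm_conjR_combLine_sub_le` (transports along one contour are `q·2dL^ka`-parallel); §3 **`exists_rightInverse_modelAvg`** (any torus
of `Setup`, any `N`, `θ < 1`).  The d = 3 carrier and the model growth theorem with `H` and the current bound discharged are the sequel `UnitScaleTiltProp7ModelGrowth`.
HONEST SCOPE: the MODEL operator (straight contours, comb transports from the block corner), not the (0.4) average of record.  Nothing of Bałaban's is asserted.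

References: T. Bałaban, CMP 95 (1984) 17–40 [Balaban1984PropagatorsI] ((1.11)–(1.12) p.19); CMP 102 (1985) 277–309 [Balaban1985Variational] ((45)–(46) p.285);
CMP 98 (1985) 17–51 [Balaban1985Averaging] (pp.24–25).
-/

noncomputable section

open scoped BigOperators Matrix.Norms.L2Operator Matrix

namespace Summit.QuantumFields.YangMills.Theorems.Prop7CovRightInverse

open Literature.MathematicalPhysics.QuantumFieldTheory.Balaban1983to89
open Finset B1RG242Torus LatticeFieldCalculus
open B7Prop1Explicit (U1 treeWord l1 e)
open B7Eq78Linearization (conjR conjR_add conjR_sub conjR_smul)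
open B8Ineq132 (norm_conjR conjR_conjR)
open B10Eq27TorusAxialLog (holT unitsField toUField transl transl_apply transl_add_e)
open B10StarCount (shift_apply_self shift_apply_ne sum_pbond)
open Summit.QuantumFields.YangMills.Theorems.Prop7CovariantCoercivity (holT_mem hyp_of_specialUnitary norm_conjR_comb_sub_le norm_nsmul_eq)

/-! ## §1 Solvability from a lower bound -/

section Solve

variable {E : Type*} [NormedAddCommGroup E] [NormedSpace ℂ E] [FiniteDimensional ℂ E]

/-- **A LINEAR ENDOMORPHISM OF A FINITE-DIMENSIONAL SPACE WITH A LOWER BOUND IS ONTO, WITH THE INVERSE BOUND**: `λ‖X‖ ≤ ‖SX‖` for all `X` (`λ > 0`) ⇒ for every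
`W` there is `X` with `SX = W` and `‖X‖ ≤ ‖W‖/λ`. [folklore] -/
theorem exists_preimage_of_le_norm (S : E →ₗ[ℂ] E) {lam : ℝ} (hlam : 0 < lam) (hS : ∀ X, lam * ‖X‖ ≤ ‖S X‖) (W : E) :
    ∃ X, S X = W ∧ ‖X‖ ≤ ‖W‖ / lam := by
  have hinj : Function.Injective S := fun X Y hXY => by
    have h := hS (X - Y)
    rw [map_sub, hXY, sub_self, norm_zero] at h
    exact sub_eq_zero.mp (norm_le_zero_iff.mp (by nlinarith [norm_nonneg (X - Y)]))
  obtain ⟨X, hX⟩ := LinearMap.injective_iff_surjective.mp hinj W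
  exact ⟨X, hX, by rw [le_div_iff₀ hlam, mul_comm, ← hX]; exact hS X⟩

variable {N : ℕ} [NeZero N]

/-- **SOLVING `Σ_i R(w_i)X = W` FOR NEARLY PARALLEL UNITARY CONJUGATIONS**: `w_i ∈ U1` (`i ∈ ι`, `|ι| = m ≥ 1`) with `‖R(w_i)X − R(w_{i₀})X‖ ≤ θ‖X‖` for all `i`,
`X`, and `θ < 1` ⇒ for every `W` there is `X` with `Σ_iR(w_i)X = W` and `‖X‖ ≤ ‖W‖/(m(1 − θ))` (`‖Σ_iR(w_i)X‖ ≥ m‖X‖ − mθ‖X‖`). [folklore] -/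
theorem exists_preimage_sum_conjR {ι : Type*} [Fintype ι] (w : ι → (Matrix (Fin N) (Fin N) ℂ)ˣ) (hw : ∀ i, w i ∈ U1 (Matrix (Fin N) (Fin N) ℂ))
    (i₀ : ι) {θ : ℝ} (hθ : θ < 1) (hnear : ∀ i X, ‖conjR (w i) X - conjR (w i₀) X‖ ≤ θ * ‖X‖) (W : Matrix (Fin N) (Fin N) ℂ) :
    ∃ X : Matrix (Fin N) (Fin N) ℂ, ∑ i, conjR (w i) X = W ∧ ‖X‖ ≤ ‖W‖ / ((Fintype.card ι : ℝ) * (1 - θ)) := by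
  -- the linear map
  let S : Matrix (Fin N) (Fin N) ℂ →ₗ[ℂ] Matrix (Fin N) (Fin N) ℂ :=
    { toFun := fun X => ∑ i, conjR (w i) X
      map_add' := fun X Y => by simp only [conjR_add, Finset.sum_add_distrib]
      map_smul' := fun c X => by simp only [conjR_smul, Finset.smul_sum, RingHom.id_apply] }
  have hm : (1 : ℝ) ≤ Fintype.card ι := by exact_mod_cast Fintype.card_pos_iff.mpr ⟨i₀⟩
  have hlam : 0 < (Fintype.card ι : ℝ) * (1 - θ) := mul_pos (by linarith) (by linarith)
  have hlow : ∀ X, (Fintype.card ι : ℝ) * (1 - θ) * ‖X‖ ≤ ‖S X‖ := by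
    intro X
    show (Fintype.card ι : ℝ) * (1 - θ) * ‖X‖ ≤ ‖∑ i, conjR (w i) X‖
    have hsplit : ∑ i, conjR (w i) X = Fintype.card ι • conjR (w i₀) X + ∑ i, (conjR (w i) X - conjR (w i₀) X) := by
      rw [Finset.sum_sub_distrib, Finset.sum_const, Finset.card_univ]; abel
    have h0 : ‖Fintype.card ι • conjR (w i₀) X‖ = Fintype.card ι * ‖X‖ := by rw [norm_nsmul_eq, norm_conjR (hw i₀)]
    have h1 : ‖∑ i, (conjR (w i) X - conjR (w i₀) X)‖ ≤ Fintype.card ι * (θ * ‖X‖) :=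
      (norm_sum_le _ _).trans ((Finset.sum_le_sum fun i _ => hnear i X).trans (by rw [Finset.sum_const, Finset.card_univ, nsmul_eq_mul]))
    rw [hsplit]
    have h3 : ‖Fintype.card ι • conjR (w i₀) X‖
        ≤ ‖Fintype.card ι • conjR (w i₀) X + ∑ i, (conjR (w i) X - conjR (w i₀) X)‖ + ‖∑ i, (conjR (w i) X - conjR (w i₀) X)‖ := by
      have := norm_sub_le (Fintype.card ι • conjR (w i₀) X + ∑ i, (conjR (w i) X - conjR (w i₀) X)) (∑ i, (conjR (w i) X - conjR (w i₀) X))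
      rwa [add_sub_cancel_right] at this
    nlinarith [h0, h1, h3]
  obtain ⟨X, hX, hXn⟩ := exists_preimage_of_le_norm S hlam hlow W
  exact ⟨X, hX, hXn⟩

end Solve

/-! ## §2 The transports of the model operator along one contour are nearly parallel -/

section Transports

variable {N : ℕ} [NeZero N] {P : Params} {k : ℕ}

/-- The block site of offset `r` is the translate of the block corner by the integer vector `r`. [folklore] -/
theorem fibreSite_eq_transl (y : Site P k) (r : Fin P.d → Fin (P.L ^ k)) :
    Site.fibreSite 0 k y r = transl (Site.fibreSite 0 k y fun _ => ⟨0, pow_pos P.L_pos k⟩) (fun ν => ((r ν : ℕ) : ℤ)) := by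
  funext ν
  simp only [Site.fibreSite, transl_apply, add_zero, Int.cast_natCast]
  push_cast
  ring

/-- Raising the `μ`-offset by one adds `e_μ` to the integer offset vector. [folklore] -/
theorem intVec_update_succ (r : Fin P.d → Fin (P.L ^ k)) (μ : Fin P.d) (s s' : Fin (P.L ^ k)) (hs' : (s' : ℕ) = s + 1) :
    (fun ν => ((Function.update r μ s' ν : ℕ) : ℤ)) = (fun ν => ((Function.update r μ s ν : ℕ) : ℤ)) + e μ := by
  funext ν; simp only [Pi.add_apply, B7Prop1Explicit.e_apply]
  by_cases hν : ν = μ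
  · subst hν; rw [Function.update_self, Function.update_self, if_pos rfl, hs']; push_cast; ring
  · rw [Function.update_of_ne hν, Function.update_of_ne hν, if_neg hν, add_zero]

/-- Raising the `μ`-offset by one is the unit shift of the torus. [folklore] -/
theorem fibreSite_update_succ (y : Site P k) (r : Fin P.d → Fin (P.L ^ k)) (μ : Fin P.d) (s s' : Fin (P.L ^ k)) (hs' : (s' : ℕ) = s + 1) :
    Site.fibreSite 0 k y (Function.update r μ s') = (Site.fibreSite 0 k y (Function.update r μ s)).shift μ := by
  funext ν
  by_cases hν : ν = μ
  · subst hν; rw [shift_apply_self]; simp only [Site.fibreSite, Function.update_self, hs']; push_cast; ring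
  · rw [shift_apply_ne _ hν]; simp only [Site.fibreSite, Function.update_of_ne hν]

/-- The `ℓ¹` length of a block offset is at most `d·L^k`. [folklore] -/
theorem l1_intVec_le' (r : Fin P.d → Fin (P.L ^ k)) : (l1 (fun ν => ((r ν : ℕ) : ℤ)) : ℝ) ≤ P.d * (P.L : ℝ) ^ k := by
  have h : ∀ ν, ((r ν : ℕ) : ℤ).natAbs ≤ P.L ^ k := fun ν => by rw [Int.natAbs_natCast]; exact (r ν).isLt.le
  have : l1 (fun ν => ((r ν : ℕ) : ℤ)) ≤ P.d * P.L ^ k := by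
    unfold l1
    calc ∑ ν, ((r ν : ℕ) : ℤ).natAbs ≤ ∑ _ν : Fin P.d, P.L ^ k := Finset.sum_le_sum fun ν _ => h ν
      _ = P.d * P.L ^ k := by simp
  exact_mod_cast this

/-- **THE TRANSPORTS OF THE MODEL OPERATOR ALONG ONE CONTOUR ARE NEARLY PARALLEL**: for a unitary background `V` with plaquette variables within `a` of `1`, the
comb transport to the site of `μ`-offset `s` followed by the straight transport of `q` steps (`s + q = L^k − 1`, arriving at the far face) differs from the comb
transport to the far-face site, in `R(·)`-operator norm, by at most `q·2dL^k a`: each of the `q` unit steps trades «comb then one bond» for «comb to the next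
site», a loop inside the block (the comb-gauge difference estimate, p473711). [cite: Balaban1985Averaging, pp.24–25] -/
theorem norm_conjR_combLine_sub_le {V : GaugeField P 0 (Matrix (Fin N) (Fin N) ℂ)ˣ} (hV : ∀ b, V b ∈ U1 (Matrix (Fin N) (Fin N) ℂ)) {a : ℝ} (ha : 0 ≤ a)
    (hplaq : ∀ (x : Site P 0) (κ κ' : Fin P.d), κ ≠ κ' → ‖((holT V x (B7Prop1Explicit.plaqWord κ κ') : (Matrix (Fin N) (Fin N) ℂ)ˣ) : Matrix (Fin N) (Fin N) ℂ) - 1‖ ≤ a)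
    (y : Site P k) (μ : Fin P.d) (r : Fin P.d → Fin (P.L ^ k)) (X : Matrix (Fin N) (Fin N) ℂ) :
    ∀ (q : ℕ) (s : Fin (P.L ^ k)), (s : ℕ) + q = P.L ^ k - 1 →
      ‖conjR (holT V (Site.fibreSite 0 k y fun _ => ⟨0, pow_pos P.L_pos k⟩) (treeWord fun ν => ((Function.update r μ s ν : ℕ) : ℤ))
              * holT V (Site.fibreSite 0 k y (Function.update r μ s)) (List.replicate q (μ, true))) X
          - conjR (holT V (Site.fibreSite 0 k y fun _ => ⟨0, pow_pos P.L_pos k⟩)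
              (treeWord fun ν => ((Function.update r μ ⟨P.L ^ k - 1, Nat.sub_lt (pow_pos P.L_pos k) one_pos⟩ ν : ℕ) : ℤ))) X‖
        ≤ q * (2 * ((P.d : ℝ) * (P.L : ℝ) ^ k * a)) * ‖X‖ := by
  set ybar : Site P 0 := Site.fibreSite 0 k y fun _ => ⟨0, pow_pos P.L_pos k⟩ with hybar
  intro q
  induction q with
  | zero =>
    intro s hs
    have hsl : s = ⟨P.L ^ k - 1, Nat.sub_lt (pow_pos P.L_pos k) one_pos⟩ := Fin.ext (by simpa using hs)
    rw [hsl, List.replicate_zero, B10Eq27TorusAxialLog.holT_nil, mul_one, sub_self, norm_zero]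
    simp
  | succ q ih =>
    intro s hs
    have hs1 : (s : ℕ) + 1 < P.L ^ k := by omega
    set s' : Fin (P.L ^ k) := ⟨(s : ℕ) + 1, hs1⟩ with hs'
    have hs'v : (s' : ℕ) = s + 1 := rfl
    have hs'q : (s' : ℕ) + q = P.L ^ k - 1 := by rw [hs'v]; omega
    -- names
    set zs : B7Prop1Explicit.Site P.d := fun ν => ((Function.update r μ s ν : ℕ) : ℤ) with hzs
    set xs : Site P 0 := Site.fibreSite 0 k y (Function.update r μ s) with hxs
    set us : (Matrix (Fin N) (Fin N) ℂ)ˣ := holT V ybar (treeWord zs) with hus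
    set ul : (Matrix (Fin N) (Fin N) ℂ)ˣ :=
      holT V ybar (treeWord fun ν => ((Function.update r μ ⟨P.L ^ k - 1, Nat.sub_lt (pow_pos P.L_pos k) one_pos⟩ ν : ℕ) : ℤ)) with hul
    set M : (Matrix (Fin N) (Fin N) ℂ)ˣ := holT V (Site.fibreSite 0 k y (Function.update r μ s')) (List.replicate q (μ, true)) with hM
    set Y : Matrix (Fin N) (Fin N) ℂ := conjR M X with hY
    clear_value Y
    have hYn : ‖Y‖ = ‖X‖ := by rw [hY]; exact norm_conjR (holT_mem hV _ _) X
    have hxs_t : transl ybar zs = xs := by rw [hxs, hzs, fibreSite_eq_transl]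
    have hz' : (fun ν => ((Function.update r μ s' ν : ℕ) : ℤ)) = zs + e μ := intVec_update_succ r μ s s' hs'v
    -- one bond off the straight transport: `u_s·V([x_s, x_s + (q+1)e_μ]) = (u_s·V(x_s, x_s+e_μ))·V([x_{s+1}, …])`
    have e1 : holT V xs (List.replicate (q + 1) (μ, true)) = V ⟨xs, μ⟩ * M := by
      rw [List.replicate_succ, B10Eq27TorusAxialLog.holT_cons_true, hM, fibreSite_update_succ y r μ s s' hs'v]
    have e2 : conjR (us * holT V xs (List.replicate (q + 1) (μ, true))) X = conjR (us * V ⟨xs, μ⟩) Y := by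
      rw [e1, ← mul_assoc, ← conjR_conjR (us * V ⟨xs, μ⟩) M X, ← hY]
    -- the induction hypothesis at `s' = s + 1`
    have hIH : ‖conjR (holT V ybar (treeWord (zs + e μ))) Y - conjR ul X‖ ≤ q * (2 * ((P.d : ℝ) * (P.L : ℝ) ^ k * a)) * ‖X‖ := by
      have h := ih s' hs'q
      rw [hz', ← hM, ← conjR_conjR _ M X, ← hY] at h
      exact h
    -- the comb step
    have hcomb : ‖conjR (holT V ybar (treeWord (zs + e μ))) Y - conjR (us * V ⟨xs, μ⟩) Y‖ ≤ 2 * ((P.d : ℝ) * (P.L : ℝ) ^ k * a) * ‖X‖ := by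
      have h := norm_conjR_comb_sub_le hV ha hplaq ybar zs μ (conjR (V ⟨transl ybar zs, μ⟩) Y) Y
      rw [sub_self, norm_zero, zero_add, norm_conjR (hV _), hxs_t, conjR_conjR (holT V ybar (treeWord zs)) (V ⟨xs, μ⟩) Y, ← hus] at h
      have hl1 : (l1 zs : ℝ) * a ≤ (P.d : ℝ) * (P.L : ℝ) ^ k * a := mul_le_mul_of_nonneg_right (l1_intVec_le' _) ha
      rw [hYn] at h
      nlinarith [h, hl1, norm_nonneg X]
    -- triangle
    rw [e2]
    calc ‖conjR (us * V ⟨xs, μ⟩) Y - conjR ul X‖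
        ≤ ‖conjR (us * V ⟨xs, μ⟩) Y - conjR (holT V ybar (treeWord (zs + e μ))) Y‖ + ‖conjR (holT V ybar (treeWord (zs + e μ))) Y - conjR ul X‖ :=
          norm_sub_le_norm_sub_add_norm_sub _ _ _
      _ ≤ 2 * ((P.d : ℝ) * (P.L : ℝ) ^ k * a) * ‖X‖ + q * (2 * ((P.d : ℝ) * (P.L : ℝ) ^ k * a)) * ‖X‖ := by
          rw [norm_sub_rev]; exact add_le_add hcomb hIH
      _ = ((q + 1 : ℕ) : ℝ) * (2 * ((P.d : ℝ) * (P.L : ℝ) ^ k * a)) * ‖X‖ := by push_cast; ring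

end Transports

/-! ## §3 The far-face right inverse -/

section RightInverse

variable {N : ℕ} [NeZero N] {P : Params} {k : ℕ}

open Summit.QuantumFields.YangMills.Theorems.Prop7FlatCoercivity (iterate_shift_eq_runSite runSite_apply_self runSite_apply_of_ne)
open Summit.QuantumFields.YangMills.Theorems.Prop7LineAvgRightInverse (val_fibreSite_mod sum_pbond_fine_eq)

/-- The `μ`-offset of the `t`-th site of the straight contour from the block site of offset `r`: `(r_μ + t) mod L^k`. [folklore] -/
theorem val_iterate_shift_fibreSite_mod (h : P.sitesPerDir 0 = P.L ^ k * P.sitesPerDir k) (y : Site P k) (r : Fin P.d → Fin (P.L ^ k))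
    (μ : Fin P.d) (t : ℕ) :
    (((fun z : Site P 0 => z.shift μ)^[t] (Site.fibreSite 0 k y r)) μ).val % P.L ^ k = ((r μ : ℕ) + t) % P.L ^ k := by
  rw [iterate_shift_eq_runSite, runSite_apply_self]
  have : (Site.fibreSite 0 k y r μ : ZMod (P.sitesPerDir 0)) + (t : ZMod (P.sitesPerDir 0))
      = (((y μ).val * P.L ^ k + ((r μ : ℕ) + t) : ℕ) : ZMod (P.sitesPerDir 0)) := by
    simp only [Site.fibreSite]; push_cast; ring
  rw [this, ZMod.val_natCast, h, mul_comm (P.L ^ k), Nat.mod_mul_left_mod, Nat.mul_add_mod']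

/-- Inside the block, the `t`-th site of the straight contour from offset `r` has offset `r + te_μ`. [folklore] -/
theorem iterate_shift_fibreSite_of_lt (y : Site P k) (r : Fin P.d → Fin (P.L ^ k)) (μ : Fin P.d) (t : ℕ) (ht : (r μ : ℕ) + t < P.L ^ k) :
    (fun z : Site P 0 => z.shift μ)^[t] (Site.fibreSite 0 k y r) = Site.fibreSite 0 k y (Function.update r μ ⟨(r μ : ℕ) + t, ht⟩) := by
  rw [iterate_shift_eq_runSite]
  funext ν
  by_cases hν : ν = μ
  · subst hν; rw [runSite_apply_self]; simp only [Site.fibreSite, Function.update_self]; push_cast; ring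
  · rw [runSite_apply_of_ne _ hν]; simp only [Site.fibreSite, Function.update_of_ne hν]

/-- The offsets of the sites behind a far-face site: `{r : r with r_μ ↦ L^k − 1 = r̄} = {r̄ with r̄_μ ↦ s : s < L^k}` (`r̄_μ = L^k − 1`). [folklore] -/
theorem filter_update_eq_image (μ : Fin P.d) (last : Fin (P.L ^ k)) (rbar : Fin P.d → Fin (P.L ^ k)) (hr : rbar μ = last) :
    (univ.filter fun r : Fin P.d → Fin (P.L ^ k) => Function.update r μ last = rbar) = univ.image fun s : Fin (P.L ^ k) => Function.update rbar μ s := by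
  ext r
  simp only [Finset.mem_filter, Finset.mem_univ, true_and, Finset.mem_image]
  constructor
  · intro hr'
    refine ⟨r μ, ?_⟩
    rw [← hr', Function.update_idem, Function.update_eq_self]
  · rintro ⟨s, rfl⟩
    rw [Function.update_idem, ← hr, Function.update_eq_self]

/-- **A COVARIANT RIGHT INVERSE OF THE LINEARISED MODEL AVERAGE AT A SMALL-FIELD BACKGROUND.**  `V` unitary with plaquette variables within `a` of `1`,
`θ = L^k·2dL^k a < 1`; `T_V` the block sums of the comb∘line-transported field (the operator of p520587/p521440/p528174).  Then there is `H` with `T_V(HW) = W`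
for every coarse field `W` and `Σ_b‖HW(b)‖ ≤ (L^k(1 − θ))⁻¹·Σ_c‖W(c)‖` — `HW` is supported on the far faces of the blocks, where it solves
`Σ_{s<L^k}R(w_{f,s})X = (#far faces)⁻¹·W(c)`. [cite: Balaban1985Variational, (45)-(46) p.285] -/
theorem exists_rightInverse_modelAvg (h : P.sitesPerDir 0 = P.L ^ k * P.sitesPerDir k)
    {V : GaugeField P 0 (Matrix (Fin N) (Fin N) ℂ)ˣ} (hV : ∀ b, V b ∈ U1 (Matrix (Fin N) (Fin N) ℂ)) {a : ℝ} (ha : 0 ≤ a)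
    (hplaq : ∀ (x : Site P 0) (κ κ' : Fin P.d), κ ≠ κ' → ‖((holT V x (B7Prop1Explicit.plaqWord κ κ') : (Matrix (Fin N) (Fin N) ℂ)ˣ) : Matrix (Fin N) (Fin N) ℂ) - 1‖ ≤ a)
    (hθ : (P.L : ℝ) ^ k * (2 * ((P.d : ℝ) * (P.L : ℝ) ^ k * a)) < 1)
    (T : (PBond P 0 → Matrix (Fin N) (Fin N) ℂ) → PBond P k → Matrix (Fin N) (Fin N) ℂ)
    (hT : ∀ Z c, T Z c = ∑ r : Fin P.d → Fin (P.L ^ k), ∑ t : Fin (P.L ^ k),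
        conjR (holT V (Site.fibreSite 0 k c.src fun _ => ⟨0, pow_pos P.L_pos k⟩) (treeWord fun ν => ((r ν : ℕ) : ℤ))
            * holT V (Site.fibreSite 0 k c.src r) (List.replicate (t : ℕ) (c.dir, true)))
          (Z ⟨(fun z : Site P 0 => z.shift c.dir)^[(t : ℕ)] (Site.fibreSite 0 k c.src r), c.dir⟩)) :
    ∃ H : (PBond P k → Matrix (Fin N) (Fin N) ℂ) → PBond P 0 → Matrix (Fin N) (Fin N) ℂ,
      (∀ W, T (H W) = W) ∧
      ∀ W, ∑ b, ‖H W b‖ ≤ ((P.L : ℝ) ^ k * (1 - (P.L : ℝ) ^ k * (2 * ((P.d : ℝ) * (P.L : ℝ) ^ k * a))))⁻¹ * ∑ c, ‖W c‖ := by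
  classical
  have hn0 : 0 < P.L ^ k := pow_pos P.L_pos k
  set last : Fin (P.L ^ k) := ⟨P.L ^ k - 1, Nat.sub_lt hn0 one_pos⟩ with hlast
  set θ : ℝ := (P.L : ℝ) ^ k * (2 * ((P.d : ℝ) * (P.L : ℝ) ^ k * a)) with hθdef
  have hnR : ((Fintype.card (Fin (P.L ^ k)) : ℕ) : ℝ) = (P.L : ℝ) ^ k := by rw [Fintype.card_fin]; push_cast; rfl
  -- the transports of the lines through a far-face bond
  let w : PBond P k → (Fin P.d → Fin (P.L ^ k)) → Fin (P.L ^ k) → (Matrix (Fin N) (Fin N) ℂ)ˣ := fun c rbar s =>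
    holT V (Site.fibreSite 0 k c.src fun _ => ⟨0, pow_pos P.L_pos k⟩) (treeWord fun ν => ((Function.update rbar c.dir s ν : ℕ) : ℤ))
      * holT V (Site.fibreSite 0 k c.src (Function.update rbar c.dir s)) (List.replicate (P.L ^ k - 1 - (s : ℕ)) (c.dir, true))
  have hw_mem : ∀ c rbar s, w c rbar s ∈ U1 (Matrix (Fin N) (Fin N) ℂ) := fun c rbar s => (U1 _).mul_mem (holT_mem hV _ _) (holT_mem hV _ _)
  have hnear : ∀ c rbar s X, ‖conjR (w c rbar s) X - conjR (w c rbar last) X‖ ≤ θ * ‖X‖ := by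
    intro c rbar s X
    have hq : (s : ℕ) + (P.L ^ k - 1 - (s : ℕ)) = P.L ^ k - 1 := by have := s.isLt; omega
    have h1 := norm_conjR_combLine_sub_le hV ha hplaq c.src c.dir rbar X (P.L ^ k - 1 - (s : ℕ)) s hq
    have hlast0 : w c rbar last = holT V (Site.fibreSite 0 k c.src fun _ => ⟨0, pow_pos P.L_pos k⟩)
        (treeWord fun ν => ((Function.update rbar c.dir ⟨P.L ^ k - 1, Nat.sub_lt (pow_pos P.L_pos k) one_pos⟩ ν : ℕ) : ℤ)) := by
      show _ * holT V _ (List.replicate (P.L ^ k - 1 - (P.L ^ k - 1)) (c.dir, true)) = _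
      rw [Nat.sub_self, List.replicate_zero, B10Eq27TorusAxialLog.holT_nil, mul_one]
    rw [hlast0]
    refine h1.trans (mul_le_mul_of_nonneg_right ?_ (norm_nonneg X))
    have hq' : ((P.L ^ k - 1 - (s : ℕ) : ℕ) : ℝ) ≤ (P.L : ℝ) ^ k := by
      have : P.L ^ k - 1 - (s : ℕ) ≤ P.L ^ k := by omega
      exact_mod_cast this
    have hC : 0 ≤ 2 * ((P.d : ℝ) * (P.L : ℝ) ^ k * a) := by positivity
    exact mul_le_mul_of_nonneg_right hq' hC
  -- solving on each far face
  have hsol : ∀ (c : PBond P k) (rbar : Fin P.d → Fin (P.L ^ k)) (W' : Matrix (Fin N) (Fin N) ℂ),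
      ∃ X : Matrix (Fin N) (Fin N) ℂ, ∑ s, conjR (w c rbar s) X = W' ∧ ‖X‖ ≤ ‖W'‖ / ((P.L : ℝ) ^ k * (1 - θ)) := by
    intro c rbar W'
    have := exists_preimage_sum_conjR (w c rbar) (hw_mem c rbar) last hθ (hnear c rbar) W'
    rwa [hnR] at this
  -- the far-face count and the solution field
  let mfar : Fin P.d → ℕ := fun μ => (univ.filter fun r : Fin P.d → Fin (P.L ^ k) => r μ = last).card
  have hmfar : ∀ μ, 0 < mfar μ := fun μ => Finset.card_pos.mpr ⟨fun _ => last, by simp⟩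
  let X : (PBond P k → Matrix (Fin N) (Fin N) ℂ) → PBond P k → (Fin P.d → Fin (P.L ^ k)) → Matrix (Fin N) (Fin N) ℂ :=
    fun W c rbar => Classical.choose (hsol c rbar (((mfar c.dir : ℝ)⁻¹) • W c))
  have hX : ∀ W c rbar, ∑ s, conjR (w c rbar s) (X W c rbar) = ((mfar c.dir : ℝ)⁻¹) • W c ∧
      ‖X W c rbar‖ ≤ ‖((mfar c.dir : ℝ)⁻¹) • W c‖ / ((P.L : ℝ) ^ k * (1 - θ)) :=
    fun W c rbar => Classical.choose_spec (hsol c rbar (((mfar c.dir : ℝ)⁻¹) • W c))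
  -- the field: on far-face bonds the solution, zero elsewhere
  let off : Site P 0 → Fin P.d → Fin (P.L ^ k) := fun z ν => ⟨(z ν).val % P.L ^ k, Nat.mod_lt _ hn0⟩
  refine ⟨fun W b => if (b.src b.dir).val % P.L ^ k = P.L ^ k - 1 then X W ⟨Site.proj k k b.src, b.dir⟩ (off b.src) else 0, fun W => ?_, fun W => ?_⟩
  · -- `T(HW) = W`
    funext c
    rw [hT]
    have hoff : ∀ r : Fin P.d → Fin (P.L ^ k), off (Site.fibreSite 0 k c.src r) = r := fun r => by
      funext ν; exact Fin.ext (val_fibreSite_mod ν h c.src r)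
    -- each contour meets the far face exactly once, at `t = L^k − 1 − r_μ`
    have hline : ∀ r : Fin P.d → Fin (P.L ^ k),
        ∑ t : Fin (P.L ^ k), conjR (holT V (Site.fibreSite 0 k c.src fun _ => ⟨0, pow_pos P.L_pos k⟩) (treeWord fun ν => ((r ν : ℕ) : ℤ))
              * holT V (Site.fibreSite 0 k c.src r) (List.replicate (t : ℕ) (c.dir, true)))
            ((fun b : PBond P 0 => if (b.src b.dir).val % P.L ^ k = P.L ^ k - 1 then X W ⟨Site.proj k k b.src, b.dir⟩ (off b.src) else 0)
              ⟨(fun z : Site P 0 => z.shift c.dir)^[(t : ℕ)] (Site.fibreSite 0 k c.src r), c.dir⟩)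
          = conjR (w c (Function.update r c.dir last) (r c.dir)) (X W c (Function.update r c.dir last)) := by
      intro r
      have htr : (r c.dir : ℕ) + (P.L ^ k - 1 - (r c.dir : ℕ)) < P.L ^ k := by have := (r c.dir).isLt; omega
      rw [Finset.sum_eq_single ⟨P.L ^ k - 1 - (r c.dir : ℕ), by omega⟩]
      · -- the far-face term
        dsimp only
        rw [val_iterate_shift_fibreSite_mod h, iterate_shift_fibreSite_of_lt c.src r c.dir _ htr]
        have hmod : ((r c.dir : ℕ) + (P.L ^ k - 1 - (r c.dir : ℕ))) % P.L ^ k = P.L ^ k - 1 := by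
          rw [Nat.mod_eq_of_lt htr]; have := (r c.dir).isLt; omega
        rw [if_pos hmod, Site.proj_fibreSite h, hoff]
        have hupd : Function.update r c.dir ⟨(r c.dir : ℕ) + (P.L ^ k - 1 - (r c.dir : ℕ)), htr⟩ = Function.update r c.dir last := by
          congr 1; exact Fin.ext (by simp only [hlast]; have := (r c.dir).isLt; omega)
        have hrr : Function.update (Function.update r c.dir last) c.dir (r c.dir) = r := by
          rw [Function.update_idem, Function.update_eq_self]
        rw [hupd]
        congr 1
        · show _ = holT V _ (treeWord fun ν => ((Function.update (Function.update r c.dir last) c.dir (r c.dir) ν : ℕ) : ℤ))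
              * holT V (Site.fibreSite 0 k c.src (Function.update (Function.update r c.dir last) c.dir (r c.dir)))
                  (List.replicate (P.L ^ k - 1 - (r c.dir : ℕ)) (c.dir, true))
          rw [hrr]
      · -- the other sites of the contour are not on the far face
        intro t _ ht
        dsimp only
        rw [val_iterate_shift_fibreSite_mod h]
        have hne : ((r c.dir : ℕ) + (t : ℕ)) % P.L ^ k ≠ P.L ^ k - 1 := by
          intro hcon
          apply ht
          apply Fin.ext
          dsimp only
          have h1 := (r c.dir).isLt; have h2 := t.isLt
          rcases lt_or_ge ((r c.dir : ℕ) + (t : ℕ)) (P.L ^ k) with hl | hl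
          · rw [Nat.mod_eq_of_lt hl] at hcon; omega
          · rw [Nat.mod_eq_sub_mod hl, Nat.mod_eq_of_lt (by omega)] at hcon; omega
        rw [if_neg hne, B7Eq78Linearization.conjR_apply, mul_zero, zero_mul]
      · intro hnot; exact absurd (Finset.mem_univ _) hnot
    rw [Finset.sum_congr rfl fun r _ => hline r]
    -- group the contours by their far-face bond
    rw [← Finset.sum_fiberwise_of_maps_to (s := (univ : Finset (Fin P.d → Fin (P.L ^ k)))) (t := univ.filter fun r : Fin P.d → Fin (P.L ^ k) => r c.dir = last)
      (g := fun r => Function.update r c.dir last) (fun r _ => by simp)]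
    have hinner : ∀ rbar ∈ univ.filter (fun r : Fin P.d → Fin (P.L ^ k) => r c.dir = last),
        ∑ r ∈ univ.filter (fun r : Fin P.d → Fin (P.L ^ k) => Function.update r c.dir last = rbar),
          conjR (w c (Function.update r c.dir last) (r c.dir)) (X W c (Function.update r c.dir last)) = ((mfar c.dir : ℝ)⁻¹) • W c := by
      intro rbar hrbar
      rw [Finset.mem_filter] at hrbar
      rw [filter_update_eq_image c.dir last rbar hrbar.2, Finset.sum_image fun s _ s' _ hss' => Function.update_injective rbar c.dir hss']
      have hupd2 : Function.update rbar c.dir last = rbar := by rw [← hrbar.2, Function.update_eq_self]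
      simp only [Function.update_idem, Function.update_self, hupd2]
      exact (hX W c rbar).1
    rw [Finset.sum_congr rfl hinner, Finset.sum_const, ← Nat.cast_smul_eq_nsmul ℝ, smul_smul,
      mul_inv_cancel₀ (Nat.cast_ne_zero.mpr (hmfar c.dir).ne'), one_smul]
  · -- the `ℓ¹` bound
    have hθ1 : 0 < 1 - θ := by linarith
    have hLk : (0 : ℝ) < (P.L : ℝ) ^ k := pow_pos (by exact_mod_cast P.L_pos) k
    rw [sum_pbond_fine_eq h]
    have hval : ∀ (μ : Fin P.d) (y : Site P k) (r : Fin P.d → Fin (P.L ^ k)),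
        ‖(if ((Site.fibreSite 0 k y r) μ).val % P.L ^ k = P.L ^ k - 1 then X W ⟨Site.proj k k (Site.fibreSite 0 k y r), μ⟩ (off (Site.fibreSite 0 k y r)) else 0)‖
          = if r μ = last then ‖X W ⟨y, μ⟩ r‖ else 0 := by
      intro μ y r
      have hoff : off (Site.fibreSite 0 k y r) = r := by funext ν; exact Fin.ext (val_fibreSite_mod ν h y r)
      rw [val_fibreSite_mod μ h y r, Site.proj_fibreSite h, hoff]
      by_cases hr : r μ = last
      · rw [if_pos hr, if_pos (by rw [hr])]
      · rw [if_neg hr, if_neg (fun hcon => hr (Fin.ext hcon)), norm_zero]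
    simp only [hval, ← Finset.sum_filter]
    have hblock : ∀ (μ : Fin P.d) (y : Site P k), ∑ r ∈ univ.filter (fun r : Fin P.d → Fin (P.L ^ k) => r μ = last), ‖X W ⟨y, μ⟩ r‖
        ≤ ((P.L : ℝ) ^ k * (1 - θ))⁻¹ * ‖W ⟨y, μ⟩‖ := by
      intro μ y
      have hb : ∀ r ∈ univ.filter (fun r : Fin P.d → Fin (P.L ^ k) => r μ = last), ‖X W ⟨y, μ⟩ r‖ ≤ ((mfar μ : ℝ)⁻¹ * ‖W ⟨y, μ⟩‖) / ((P.L : ℝ) ^ k * (1 - θ)) := by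
        intro r _
        have := (hX W ⟨y, μ⟩ r).2
        rwa [norm_smul, norm_inv, Real.norm_natCast] at this
      refine (Finset.sum_le_sum hb).trans ?_
      rw [Finset.sum_const, nsmul_eq_mul]
      have hm0 : (0 : ℝ) < mfar μ := by exact_mod_cast hmfar μ
      rw [show ((univ.filter fun r : Fin P.d → Fin (P.L ^ k) => r μ = last).card : ℝ) = mfar μ from rfl]
      field_simp
      rfl
    calc ∑ μ : Fin P.d, ∑ y : Site P k, ∑ r ∈ univ.filter (fun r : Fin P.d → Fin (P.L ^ k) => r μ = last), ‖X W ⟨y, μ⟩ r‖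
        ≤ ∑ μ : Fin P.d, ∑ y : Site P k, ((P.L : ℝ) ^ k * (1 - θ))⁻¹ * ‖W ⟨y, μ⟩‖ :=
          Finset.sum_le_sum fun μ _ => Finset.sum_le_sum fun y _ => hblock μ y
      _ = ((P.L : ℝ) ^ k * (1 - θ))⁻¹ * ∑ c : PBond P k, ‖W c‖ := by
          rw [sum_pbond (fun c : PBond P k => ‖W c‖), Finset.sum_comm]
          simp only [← Finset.mul_sum]

end RightInverse

end Summit.QuantumFields.YangMills.Theorems.Prop7CovRightInverse

end
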